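import Literature.NumberTheory.EllipticCurves.Skinner2016.HidaCongruentMembers
import Literature.NumberTheory.EllipticCurves.BDPAnticyclotomicPAdicLFunctionSigmaInt
import Literature.NumberTheory.EllipticCurves.SigmaEulerData
import HarnessLib

/-!
# Castella JIMJ 19 (2020) Thm. 2.11 ∘ Castella CJM 6 (2018) (3.1)/(4.1) ∘ Skinner 2016 §2.6: the Σ-imprimitive `p`-adic
# `L`-functions of the HIDA MEMBERS `g_m ∈ S_{k_m}(Γ₀(N/p))` of a `p`-new weight-2 newform `f = f_E` (`p ∥ N`) are CONGRUENT
# mod `p^m` to `L^Σ_p(f) = L_p(f)·P_Σ` — the FORM-LEVEL, IMAGE-FREE twin of `ErratumHidaMembersFrames.lean` (members as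
# `Skinner2016.HidaCongruentForm`, no residual hypothesis, weights in every class `k ≡ 2 (mod 2(p−1)p^r)`), for EVERY weight-2 frame

Cell `bsd-eis` (home `run/shared/lean/pub/bsd-eis/`), width seat `bsd-line-x2-p2` g13, for crux 4 `BSDpOnCellC`
(stmt-BirchSwinnertonDyer-19034), line «crystal» (LEAD `cruxlead-19034`), registered stub `stub_crystallineFibre` (I) «the crystalline
fibre congruence» — the LEAD's `Cruxes/BSDpOnCellC/STUB-PLAN-memberInvariants.md` §2 asks for exactly this typing ("a Literature
existence fact over the tree's `Skinner2016.HidaCongruentForm` / `IsBDPLFunctionWtSigmaInt` receptacles … then (I) = «two specialisations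
of one power series at weights 2 and k₁ are congruent mod p»"). ONE named `Prop` (D-0014; a CONJUNCTION OF PUBLISHED RESULTS, each
cited; no definition besides the `Prop`, no instance, no theorem, no `sorry`); nothing about any curve or form is asserted.

## Why a second file next to `ErratumHidaMembersFrames.lean` (F3♯, cell `bsd-stepL`)

F3♯ (`erratum_exists_frames_members_sigma_congruence_nonsplit`) types the SAME published chain for Castella's erratum: it carries the
erratum's hypotheses `Irr W p`, the non-split witness `q`, the LATTICE clause (b) (`Skinner2016.HidaCongruentMember`) and footnote 1's
residual properties — all irrelevant to, and the first two FALSE on, crux 4's cell (`E[p]` REDUCIBLE). The links that do not see the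
residual image are: the Hida family through the `p`-stabilised-new `f_E` and its classical members [Cas20 §1.1 ← Hida86b, `p` odd],
their congruence depth [Ski16 §2.6], the two-variable `ℒ_{𝔭,ξ}(𝐟)` and its specialisation [Cas20 Def. 2.10 / Thm. 2.11; Cas18 (4.1)],
`L^Σ` [Cas18 (3.1), JSW17 §5.1]. This file records exactly those, for the FORM part `Skinner2016.HidaCongruentForm` (structure (a) of F2),
and adds the freedom print gives in the WEIGHT CLASS (Ski16 §2.6: "if `k′ ≡ k (mod (p−1)p^{r_m})` then `φ_{k′} ≡ φ_0 (mod p^m)`" — any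
extra divisibility `2(p−1)p^r ∣ k′ − 2` may be imposed), which crux 4's parity clause needs.

## Source, verbatim

* [Castella2020JIMJ] §1.1 (arXiv:1410.6591 p0005 L7–L50): "Fix an integer `N ≥ 1`, and let `p` be an odd prime not dividing `N`. … If
  `g ∈ S_k(Γ₀(Np))` is any ordinary `p`-stabilized newform of weight `k ≡ 2 (mod p−1)` of tame level `N` … [whose] system of Hecke
  eigenvalues agrees with that of a newform of level `N` or `Np`, then by [hida86b] there exists a finite flat extension `𝓡` of `Λ_𝒪` and
  an ordinary `𝓡`-adic newform `𝐅 ∈ 𝓡⟦q⟧` of tame level `N` such that `𝐟_{ν_g} = g` for a unique `ν_g ∈ 𝒳_arith(𝓡)`"; §1.5 Def. 1.3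
  (p0006 L83–L110: `ℒ_{𝔭,ξ}(𝐅)(ν, φ) := Σ_{[𝔞]∈Pic(𝒪)} ξ_νχ_ν(𝔞) ∫_{ℤ_p^×} φ|[𝔞] dμ_{d^{-1}𝐅_ν^{[p]}|[𝔞]}` — at each arithmetic `ν` the
  BDP construction applied to the `p`-DEPLETED specialisation); journal numbering Def. 2.10 / **Thm. 2.11** (J. Inst. Math. Jussieu 19
  (2020) p. 12, as quoted by F3♯): "Let `ν ∈ 𝒳_𝒪(𝕀)` of weight `(k, 𝟙)` with `k ≥ 1` be such that `𝐟_ν` is classical … Then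
  `ν(ℒ_{𝔭,ξ}(𝐟))(φ̂)² / Ω_p^{2k+4ℓ} = L^alg(f_ν/K, χ_νξ_νφ, k_ν − 1) · 𝓔_𝔭(f_ν, χ_νξ_νφ)² · φ(𝔑⁻¹) · 2³ · c_o ε(f_ν) · w_K² √D_K`"
  (the SAME CM periods `(Ω_K, Ω_p)` at every `ν`; Rem. 2.12: central values); §1.2 standing (p0005 L52–L56): `K` imaginary quadratic,
  `p` split, "`D` odd, `p` does not divide the class number of `K`, and there is an ideal `𝔑` with `𝒪/𝔑 ≅ ℤ/N`" — see flag `MF-hK`.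
* [Castella2018] Camb. J. Math. 6 (2018) §4 (arXiv:1704.06608 p0010 L80–L100): "`L_p^Σ(𝐟) ∈ Λ_{𝓡,R₀}` is such that
  **(4.1)** `L_p^Σ(𝐟) mod ℘̃_φ = L_p^Σ(𝐟_φ)` for all `φ ∈ 𝒳^a_𝓡`. Proof. Let `ℒ_{𝔭,ξ}(𝐟) ∈ Λ_{𝓡,R₀}` be the two-variable anticyclotomic
  `p`-adic `L`-function constructed in [cas-2var] … the proof of [cas-2var] shows that `L_p(𝐟)` reduces to `L_p(𝐟_φ)` modulo `℘̃_φ`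
  for all `φ` … if for any Σ as above we set `L_p^Σ(𝐟) := L_p(𝐟) × ∏_{w∈Σ} P_{𝐟,w}(εΨ^{-1}(γ_w))` … the specialization property (4.1)
  thus follows"; (3.1) (p. 9): `L^Σ_p(f) := L_p(f) × ∏_{w∈Σ} P_w(εΨ^{-1}(γ_w))`; Thm. 3.1 (the frame `L_p(f)`, tree `IsBDPLFunction` /
  the wide receptacle `R1.IsBDPLFunctionInt`, `IsBDPLFunctionWtSigmaInt … 2 … ∅`).
* [Castella2018Erratum] proof of Thm. 1.1 (p. 4), (a) and (c): "for each `m ≥ 1` there exists (a) a `p`-ordinary newform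
  `g_m ∈ S_{k_m}(Γ₀(M))` … of weight `k_m > 2` with `k_m ≡ 2 (mod p − 1)` … (c) an equality `(L^Σ_p(g_m), p^m) = (L^Σ_p(f), p^m) ⊂ Λ_𝒪^ur`.
  Indeed, (a) … follow[s] from Hida theory (see the discussion in [Ski16, §2.6]), and (c) follows from [Cas20, Thm. 2.11]" — (a) and (c)
  use NO hypothesis on `ρ̄` ((b) and footnote 1 do; they are not transcribed here).
* [Skinner2016PacificMC] §2.6 (arXiv:1407.1093 p0011 L62–p0012 L70): "… if `φ : R → ℚ̄_p` … `φ(1 + X) = (1 + p)^{k′}` with `k′ > 2` and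
  `k′ ≡ k (mod p − 1)`, then `Σ φ(a_n)q^n` is the `q`-expansion of a `p`-stabilized newform … there is a newform `f_φ ∈ S_{k′}(Γ₀(M))` …
  given any integer `m > 0`, there is an integer `r_m > 0` such that if `k′ ≡ k (mod (p−1)p^{r_m})`, then `φ_{k′} ≡ φ_0 (mod p^m 𝒪)`; in
  particular, for all primes `ℓ ≠ p`, `a_ℓ(f_{φ_{k′}}) ≡ a_ℓ(f) (mod p^m 𝒪)`".
* [JetchevSkinnerWan2017] §5.1 (the Σ-imprimitive function interpolates the incomplete values — the tree's `IsBDPLFunctionWtSigmaInt`);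
  [EmertonPollackWeston2006] Thm. 2.1.2, §3.1 and [Wiles1988] Thm. 2.2.2 (the integral ordinary datum `OrdinaryNewformDatum` of a
  `p`-ordinary newform — the field `Δ` of `HidaCongruentForm`).

## Transcription (tree vocabulary only; nothing re-declared)

`f = f_E`: `W/ℚ` globally minimal elliptic of conductor `N`, `f` its newform (`IsNewformOf W f`), `p` an ODD prime (`2 < p`) of
multiplicative reduction (`Mult W p`: `p ∥ N`, `M = N/p` prime to `p`, `f` is `p`-stabilised-new and ordinary); `K` imaginary quadratic
with (Heeg) for `N` (hence for `M`, and `p` split), `d_K` odd and `< −4`; `𝔭 ∋ p` the prime induced by `ι : ℚ̄_p ≃ ℂ`; `κ` THE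
anticyclotomic `ℤ_p`-extension with topological generator `γ` (`T = γ − 1`); the structure map `j : ℤ_p → 𝓞_{ℂ_p}` (characterised by
its values in `ℂ_p`, as F3♯'s receptacle maps). FOR EVERY weight-2 frame `Q ∈ 𝓞_{ℂ_p}⟦T⟧` of `f` at periods `(Ω_K ≠ 0, ‖Ω_p‖ = 1)`
(`IsBDPLFunctionWtSigmaInt ι 𝔭 κ γ f ∅ Ω_K Ω_p Q` — the weight-2, Σ = ∅ case of D3′, which IS Castella's Thm. 3.1 frame read in
`𝓞_{ℂ_p}⟦T⟧`, `isBDPLFunctionWtSigmaInt_empty_iff_isBDPLFunction_of_coeff_eq` / `bdpInterpolationValueWtSigma_empty_two`; no frame is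
ASSERTED to exist), for every depth `m ≥ 1` and every `r`: THERE ARE a member FORM `D : Skinner2016.HidaCongruentForm W p m` (a newform
`g_m ∈ S_{k_m}(Γ₀(N/p))`, `k_m > 2`, `(p−1) ∣ k_m − 2`, `D.ι`-ordinary, `a_ℓ(g_m) ≡ a_ℓ(E) mod p^m` at `ℓ ∤ N`, with an integral ordinary
datum) whose coefficient embedding IS the fixed one, `ι (D.ι x) = x` (flag `MF-compat`), whose weight satisfies
`2(p−1)p^r ∣ k_m − 2` (Ski16's free weight class), and a Σ-imprimitive weight-`k_m` frame `Q_m` of `g_m` AT THE SAME PERIODS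
(`IsBDPLFunctionWtSigmaInt ι 𝔭 κ γ D.g Σ(W,p)(K) Ω_K Ω_p Q_m`, `Σ(W,p)(K) = W.sigmaPlacesFinset p K` = the places over `M`) with
(c) `(Q_m) + (p^m) = (Q · j(P_Σ)) + (p^m)` in `𝓞_{ℂ_p}⟦T⟧`, `P_Σ = W.sigmaEulerElement p K κ` [`L^Σ_p(f) = L_p(f)·P_Σ`, Cas18 (3.1)].

## Flags (nothing hidden; each is a rider a referee must check — the label «composed PUB-chain» vs «preprint-grade display» is
## the referee's / director's (ruling (318)(1)), not the filer's)

* `MF-chain`: a CONJUNCTION of published statements ([Cas20 §1.1 ← Hida86b], [Ski16 §2.6], [Cas20 Def. 2.10/Thm. 2.11], [Cas18 (3.1),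
  (4.1) and p. 11], [JSW17 §5.1], [EPW06 §3.1 / Wiles88 2.2.2]) exactly as the erratum's proof of Thm. 1.1 (a)(c) assembles them, MINUS
  every link that uses the residual image; cited link by link; not a single printed display.
* `MF-anyframe`: print's (c) is for Castella's own `L^Σ_p(f)` (CM periods of [CH18 §2.5]); here it is stated for EVERY frame `Q` of `f`
  at any admissible periods and the member frame is produced AT THE SAME periods. Justification: two frames of `f` in `𝓞_{ℂ_p}⟦T⟧` at
  periods `(Ω_K, Ω_p)`, `(Ω_K′, Ω_p′)` differ by a UNIT `U` of `𝓞_{ℂ_p}⟦T⟧` interpolating `n ↦ (Ω_pΩ_K′/Ω_p′Ω_K)^{4n}` (TREE THEOREM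
  `X11b.R1.exists_unit_mul_eq_of_isBDPLFunctionInt` / `R1.span_singleton_eq_of_isBDPLFunctionInt`, odd `p`, `K` imaginary quadratic,
  `κ` anticyclotomic), the weight-`k` frame scales by the SAME `Ω^{4n}` (D3′), so `U·L^Σ_p(g_m)` is a frame of `g_m` at the new periods
  and (c), an IDEAL statement, is unchanged. If no frame of `f` exists at the given periods the statement is vacuous.
* `MF-p3`: stated for ODD `p` as [Cas20 §1.1] ("let `p` be an odd prime") and [Ski16] state it; [Hida86b]'s printed range is `p ≥ 5` and
  [Cas18]'s standing is `p > 3` — at `p = 3` the Hida-theoretic links rest on the odd-`p` extensions of Hida's control theorem (Wiles 1988;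
  Hida's later expositions); crux 4's rider «p = 3» (LEAD's (I) docstring) is exactly this.
* `MF-hK`: [Cas20] §1.2 assumes `p ∤ h_K` ("we assume … that `p` does not divide the class number of `K`"); it is NOT a binder here,
  following F3♯ and [Cas18] §4 / the erratum (c), which use `L_p(𝐟)` and (4.1) for `K` subject only to (Heeg)/(spl) (Thm. A, §4 standing) —
  the class-number hypothesis serves [Cas20] §§3–4 (big Heegner points, "for simplicity"), not Def. 2.10 / Thm. 2.11; a referee who reads
  §1.2's sentence as governing Thm. 2.11 too should ask for the binder `¬ p ∣ h_K` (then crux 4's (I) needs it as well).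
* `MF-sp-factor` (= F3♯'s): the `p`-NEW weight-2 point — `(4.1)` at `𝐟_φ = f_E` — is [Cas18, p. 11 L9–11] by reference to the proof of
  [Cas20, Thm. 2.11] (`𝐟_ν` "classical" of weight `(2, 𝟙)`), no separate display; the member points are ordinary `p`-stabilisations of
  the `g_m` and Thm. 2.11 applies to them verbatim (its Euler factor `𝓔_𝔭(f_ν,·)²` at `ν = ν_{g_m}` is the tree's
  `(1 − a_p(g)p^{−k/2}φ(𝔭) + p^{−1}φ(𝔭)²)²` of D3/D3′, at `ν₂` it is `(1 − a_p p^{−1}φ(𝔭))²`, `ε_p = 0` for `p ∣ N`).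
* `MF-sigma`: Σ-imprimitivity at weight `k` uses the member's own Euler factors (`P_{𝐟,w}` specialised, [Cas18 (4.1)]; D3′'s
  `rankinSelbergLocalFactorInvHeckeWt`), at weight 2 the curve's (`P_Σ(E/K)`); their congruence mod `p^m` is part of (4.1)
  (`a_ℓ(g_m) ≡ a_ℓ(E) mod p^m` for ALL `ℓ ≠ p`, Ski16 §2.6 — the structure `HidaCongruentForm` records it at `ℓ ∤ N` only — and
  `ℓ^{(k_m−2)/2} ≡ 1 mod p^m` for the central normalisation, which the depth of the chosen member provides).
* `MF-compat`, `MF-receptacle` (`𝓞_{ℂ_p}⟦T⟧ ⊇ Λ_𝒪^ur`), `MF-periods`, `MF-own-ring`, `MF-per-m`: as F3♯.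
* `MF-depth`: the member is chosen at a weight `k_m ≡ 2 (mod 2(p−1)p^R)`, `R ≥ max(r, r_m)`: the `∃` hides the depth; only
  `2(p−1)p^r ∣ k_m − 2` and the `p^m`-congruences are displayed.
STATUS: PUB chain (every link refereed: Cas20 JIMJ, Cas18 CJM, Ski16 PJM, JSW17 CJM, EPW06, Wiles88, Hida86) with the riders above;
take as a hypothesis; discharging it = typing Hida theory and the BDP measures. Crux 4's (I) is its instance `m = 1`, `r = 0` composed with
the tree's frame rigidity (Theorems-side glue, `--supports stmt-BirchSwinnertonDyer-19034`).

## References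

* [Castella2020JIMJ] J. Inst. Math. Jussieu 19 (2020) 2127–2164, §1.1, §1.2, §2.5, Def. 2.10, Thm. 2.11, Rem. 2.12 (arXiv:1410.6591 §1.1, §1.5
  Def. 1.3, Thm. 1.4 (i)).
* [Castella2018] Camb. J. Math. 6 (2018), Thm. 3.1, (3.1) (p. 9), §4 (4.1) and p. 11 L9–11. [Castella2018Erratum] proof of Thm. 1.1 (a)(c) (p. 4).
* [Skinner2016PacificMC] Pacific J. Math. 283 (2016), §2.6 (2-6-1), §3.1 (a). [Hida1986] Invent. Math. 85 / Ann. Sci. ÉNS 19 (1986).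
* [JetchevSkinnerWan2017] §5.1. [CastellaHsieh2018] §2.5, Def. 3.7, Prop. 3.8. [EmertonPollackWeston2006] Thm. 2.1.2, §3.1. [Wiles1988] Thm. 2.2.2.
* Tree: `Skinner2016/HidaCongruentMembers.lean` (F2: `HidaCongruentForm`), `BDPAnticyclotomicPAdicLFunctionSigmaInt.lean` (D3′),
  `SigmaEulerData.lean` (`sigmaPlacesFinset`, `sigmaEulerElement`), `Castella2018/ErratumHidaMembersFrames.lean` (F3♯, the irreducible twin),
  `Summits/…/X11b/FrameIdealRigidity.lean` (`R1.span_singleton_eq_of_isBDPLFunctionInt`, cross-period rigidity).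
-/

noncomputable section

open scoped Classical

open PowerSeries WeierstrassCurve NumberField IsDedekindDomain Field
  Literature.NumberTheory.EllipticCurves Literature.NumberTheory.EllipticCurves.ModularForms
  Literature.NumberTheory.EllipticCurves.Rank1Residual Literature.NumberTheory.EllipticCurves.BigGaloisRep
  Literature.NumberTheory.EllipticCurves.GreenbergSelmer Literature.NumberTheory.GaloisRepresentations

namespace Literature.NumberTheory.EllipticCurves.Castella2018

/-- **Castella 2020 Thm. 2.11 ∘ Castella 2018 (3.1)/(4.1) ∘ Skinner 2016 §2.6 (∘ Hida 1986, EPW06/Wiles88) — the FORM-LEVEL, IMAGE-FREE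
member congruences of the `p`-adic `L`-functions in the Hida family through a `p`-new weight-2 newform** (the erratum's (a)+(c) without
(b)/footnote 1; twin of `erratum_exists_frames_members_sigma_congruence_nonsplit` for `Skinner2016.HidaCongruentForm`). As printed
(erratum p. 4): "for each `m ≥ 1` there exists (a) a `p`-ordinary newform `g_m ∈ S_{k_m}(Γ₀(M))` … `k_m > 2`, `k_m ≡ 2 (mod p − 1)` …
(c) `(L^Σ_p(g_m), p^m) = (L^Σ_p(f), p^m)` … (a) … from Hida theory ([Ski16, §2.6]) and (c) from [Cas20, Thm. 2.11]", with Ski16 §2.6's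
free weight class ("if `k′ ≡ k (mod (p−1)p^{r_m})` then `φ_{k′} ≡ φ_0 (mod p^m)`") displayed as `2(p−1)p^r ∣ k_m − 2` for any prescribed
`r`, and Cas18 (3.1) `L^Σ_p(f) = L_p(f)·P_Σ`. Transcription (module docstring): for `W/ℚ` globally minimal elliptic with newform `f` of
level `N`, an odd prime `p ∥ N`, `K` imaginary quadratic with (Heeg) for `N`, `d_K` odd `< −4`, `p` split, `𝔭` induced by `ι`, `κ`
anticyclotomic with generator `γ`, the structure map `j : ℤ_p → 𝓞_{ℂ_p}`, and EVERY weight-2 frame `Q` of `f` in `𝓞_{ℂ_p}⟦T⟧` at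
periods `(Ω_K ≠ 0, ‖Ω_p‖ = 1)`: for every `m ≥ 1` and `r`, THERE ARE a member form `D : Skinner2016.HidaCongruentForm W p m` with
`ι ∘ D.ι = id` and `2(p−1)p^r ∣ D.k − 2`, and a Σ-imprimitive weight-`D.k` frame `Q_m` of `D.g` at the SAME periods, with
`(Q_m) + (p^m) = (Q · j(P_Σ(E/K))) + (p^m)`. Flags `MF-chain`, `MF-anyframe` (tree rigidity), `MF-p3`, `MF-hK` (Cas20 §1.2's
`p ∤ h_K` NOT a binder — referee's call), `MF-sp-factor`, `MF-sigma`, `MF-compat`, `MF-depth`: module docstring. A conjunction of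
published results (D-0014); nothing about `p`-adic `L`-functions is constructed and no frame is asserted to exist (∀-frame).
[cite: Castella2020JIMJ, §1.1, Def. 2.10, Thm. 2.11 and Rem. 2.12 (J. Inst. Math. Jussieu 19 (2020) p. 12; arXiv:1410.6591 §1.1, §1.5 Def. 1.3, Thm. 1.4 (i))]
[cite: Castella2018, Thm. 3.1, (3.1) (p. 9), §4 (4.1) and p. 11 L9–11 (arXiv:1704.06608 pp. 9–11)]
[cite: Castella2018Erratum, proof of Thm. 1.1 (a)(c) (p. 4)]
[cite: Skinner2016PacificMC, §2.6 (2-6-1) and §3.1 (a) (Pacific J. Math. 283 (2016) p. 192; arXiv:1407.1093 pp. 11–13)]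
[cite: Hida1986, Thm. I] [cite: JetchevSkinnerWan2017, §5.1 (arXiv:1512.06894 tex p0022 L41–50)]
[cite: EmertonPollackWeston2006, Thm. 2.1.2 and §3.1] [cite: Wiles1988, Thm. 2.2.2] [cite: CastellaHsieh2018, §2.5, Def. 3.7, Prop. 3.8] -/
def cas20_thm211_memberForms_sigmaFrames_congr : Prop :=
  ∀ {p : ℕ} [Fact p.Prime] (ι : PadicAlgCl p ≃+* ℂ) (W : WeierstrassCurve ℚ) [W.IsElliptic]
    [W.IsGloballyMinimal] (K : Type) [Field K] [NumberField K]
    (𝔭 : HeightOneSpectrum (𝓞 K)) (κ : ZpExtension K p) (γ : absoluteGaloisGroup K)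
    [Fact (κ.IsTopGenerator γ)] {N : ℕ} [NeZero N] {f : CuspForm (CongruenceSubgroup.Gamma0 N) 2}
    (_ : IsNewformOf W f),
    -- `f = f_E` of level `N`, `p` an ODD prime with `p ∥ N` (so `M = N/p` is prime to `p` and `f` is `p`-stabilised-new, ordinary)
    W.conductorNorm ℤ = N → 2 < p → Mult W p →
    -- `K` imaginary quadratic, `d_K` odd and `< −4`, Heegner for `N`, `p = 𝔭𝔭̄` split, `𝔭` the prime induced by `ι`
    IsImaginaryQuadratic K → Odd (NumberField.discr K) → NumberField.discr K < -4 → SatisfiesHeegnerHypothesis N K →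
    ((Ideal.span {(p : ℤ)}).primesOver (𝓞 K)).ncard = 2 →
    ((p : ℕ) : 𝓞 K) ∈ 𝔭.asIdeal →
    (∀ (w : InfinitePlace K) (x : 𝓞 K), x ∈ 𝔭.asIdeal ↔ ‖ι.symm (w.embedding (x : K))‖ < 1) →
    -- `Γ` THE anticyclotomic `ℤ_p`-extension
    κ.IsAnticyclotomic →
    -- the structure map `j : ℤ_p → 𝓞_{ℂ_p}` of the receptacle (characterised by its values in `ℂ_p`)
    ∀ (j : ℤ_[p] →+* PadicComplexInt p),
      (∀ x : ℤ_[p], ((j x : PadicComplexInt p) : ℂ_[p]) = algebraMap ℚ_[p] ℂ_[p] (x : ℚ_[p])) →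
    -- EVERY weight-2 frame `Q` of `f` in `𝓞_{ℂ_p}⟦T⟧` at periods `(Ω_K ≠ 0, ‖Ω_p‖ = 1)` [Cas18 Thm. 3.1 read in the wide receptacle; D3′ at `k = 2`, `Σ = ∅`]
    ∀ (ΩK : ℂ) (Ωp : ℂ_[p]) (Q : PowerSeries (PadicComplexInt p)), ΩK ≠ 0 → ‖Ωp‖ = 1 →
      IsBDPLFunctionWtSigmaInt ι 𝔭 κ γ f ∅ ΩK Ωp Q →
    -- THEN for every depth `m ≥ 1` and every weight-class exponent `r`:
    ∀ m : ℕ, 1 ≤ m → ∀ r : ℕ,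
      ∃ (D : Skinner2016.HidaCongruentForm W p m) (Qm : PowerSeries (PadicComplexInt p)),
        -- the member's `p`-adic coefficient embedding IS the fixed `ı_p = ι⁻¹` on `ℚ(g_m) ⊂ ℂ` (flag `MF-compat`)
        (∀ x : coeffField D.g, ι (D.ι x) = (x : ℂ)) ∧
        -- Ski16 §2.6's free weight class: `k_m ≡ 2 (mod 2(p−1)p^r)`
        2 * ((p : ℤ) - 1) * (p : ℤ) ^ r ∣ D.k - 2 ∧
        -- `Q_m = L^Σ_p(g_m)` at the SAME periods: the Σ-imprimitive weight-`k_m` frame of `g_m` [Cas20 Thm. 2.11, Cas18 (4.1), JSW17 §5.1]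
        IsBDPLFunctionWtSigmaInt ι 𝔭 κ γ D.g (W.sigmaPlacesFinset p K) ΩK Ωp Qm ∧
        -- (c): `(L^Σ_p(g_m)) + (p^m) = (L_p(f)·P_Σ) + (p^m)` in `𝓞_{ℂ_p}⟦T⟧` [erratum (c) ← Cas20 Thm. 2.11; Cas18 (3.1)]
        Ideal.span {Qm} ⊔ Ideal.span {(PowerSeries.C (((p : ℕ) : PadicComplexInt p) ^ m))} =
          Ideal.span {Q * PowerSeries.map j (W.sigmaEulerElement p K κ)} ⊔
            Ideal.span {(PowerSeries.C (((p : ℕ) : PadicComplexInt p) ^ m))}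

end Literature.NumberTheory.EllipticCurves.Castella2018

end
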